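import Summits.ABC.IUTFork.Repair.RHSlotReach
import Summits.ABC.IUTFork.Repair.ObstructionSS28Window
import HarnessLib

/-!
# R-H ROUND 1+ (D-0079 «local-height condition I06⋆», rung LADDER-ABC:A2.RESCUE.H), lens NEARMISS seat 1/3 — candidate `reach-ledger`:
# the LABEL-AVERAGED MOVER-REACH LEDGER `HStarReachLedger` (hypothesis shape, claim-tagged; never asserted, never a Literature fact)

[R-H candidate, hypothesis — not a fact]. Author abc-iut-lens-nearmiss-1 (planner, ideation + typing only; no routes, no estimates, nothing
landed). TAKES NO SIDE on [IUTchIII] Cor. 3.12 or on any author; typed ≠ proved; instantiated ≠ endorsed; nothing here asserts abc proved or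
refuted. Imports tree modules only; TWO bookkeeping `def … : Prop` (the abstract candidate and its genuine-`K` instance) over integer
arithmetic helpers; no instance, no notation, no theorem about any bed.

THE NEAR-MISS (lens output). The argument of record with a MEASURED deficit is the cellwise multi-slot MOVER-REACH law (R-H rows 15/20:
`Repair.RHSlotReach.SlotReachWindow`, lens-control-1's `linear-reach-law`; door (a) = abc-iut-w5-d107 `Thm311.Real.licence_settingPrVolSharp_of_multiReach`):
at the bad place `w ∣ p` (absolute index `e = e_w`, Kummer-root order `m_q = ord_w(q̲)`), label `j`, the `j+1` donor slots each reach
`D(p,e) := (e − 1) + (c(p,e) − r_out♯(p,e))` `w`-units (`c` = inner conductor of record ⌊e/(p−1)⌋+1, minus 1 on `(p−1) ∣ e` rows; `r_out♯ =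
min_t (p^t − t·e)` = abc-iut-rp-x2's sharp outer order, ATTAINED off the cyclotomic indices by `Literature.IUT.LogVolume.UnitLogMaxNorm`
`exists_mem_logUnits_norm_eq_envelope`), against the demand `(j²−1)·m_q + e`. Measured (plan/rescue/R-H/HULL-REACH-K1.txt 1c653fb1fd740e86):
POS on 1351/1582 = 85.4 % of the S_H-not-refuted groups, binding at the TOP labels, while the low labels carry unused reach. THE SINGLE INPUT
TO IMPROVE: account the reach in VOLUME and let the procession average (uniform over `j ∈ 𝔽_l^⋇`, `Literature.IUT.LogThetaLattice.processionNormalized`)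
transfer low-label surplus to top-label deficit — the typed Corollary IS the averaged cell slack
(`Repair.ObstructionSS28Window.statement_iff_avg_cellSlack`). Conservatively the per-cell volume surplus/deficit is counted in whole
`p`-LEVELS (units of `log p` per packet): `⌊slack/e⌋`.

THE CANDIDATE (per bad place; no cross-place financing; exact integers):
  `H⋆_RL(w) :⟺ 0 ≤ Σ_{j=1}^{l⋆} ⌊((j+1)·D(p,e_w) − (j²−1)·m_q(w) − e_w) / e_w⌋`.
Cellwise reach-POS at every label ⟹ `H⋆_RL` (sum of nonnegatives); the converse fails (that is the point). k2 route (door (b), volume):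
NEW LEMMA «mover surplus ⟹ cell slack» (the crux, not in the tree) + `statement_iff_avg_cellSlack` ⟹ `Cor312.Setting.Statement` of
`Thm311.Real.settingPrVolSharp (Cor312Prov.pilotDataOfK T.D T.K) …` = binder `hstBad` of `Conditional.abc_of_cor312Statement_genuineK_szpiroBad_hregBad`.
NOT S_H-sufficient (cellwise containment may fail where `H⋆_RL` holds); Statement-sufficient by design — see CARD-reach-ledger.md.
[cite: Mochizuki2012, IUTchIII Prop. 3.9 (i) p. 116; Rmk 3.9.3 pp. 119–120] [cite: NeukirchANT1999, Ch. II (5.5)] [claim: Mochizuki2012, status: disputed]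
-/

noncomputable section

namespace Summit.ABC.IUTFork.Repair.RH.ReachLedger

/-! ## §1. Integer column vocabulary (I06STAR-COLUMNS v3 cols 5, 31, 32; HULL-REACH-K1 row 20 donor `D`) -/

/-- Sharp outer order `r_out♯(p,e) = min_{0 ≤ t ≤ e} (p^t − t·e)` (col 32 `r_out_sharp`; the minimum over all `t ≥ 0` is attained at the turning
point `t = a₀ ≤ e`). Computable (list fold, seed = value `1` at `t = 0`). [cite: NeukirchANT1999, Ch. II (5.5)] -/
def rOutSharp (p e : ℕ) : ℤ :=
  ((List.range (e + 1)).map fun t : ℕ => (p : ℤ) ^ t - (t : ℤ) * (e : ℤ)).foldl min 1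

/-- Inner conductor of record (row 20 convention): `⌊e/(p−1)⌋ + 1` (col 31 `r_in_ub`, certified `𝔪^{r} ⊆ log_p 𝒪^×`,
`Repair.CandInternal2RealStrata.pBall_subset_logUnits_of_lt`) when `(p−1) ∤ e`, else the tie-row value `⌊e/(p−1)⌋`. [folklore] -/
def innerCond (p e : ℕ) : ℤ :=
  if (p - 1) ∣ e then ((e / (p - 1) : ℕ) : ℤ) else ((e / (p - 1) : ℕ) : ℤ) + 1

/-- Per-slot reach `D(p,e) = (e − 1) + (c − r_out♯)` in `w`-units (lens-control-1 `linear-reach-law`, HULL-REACH-K1 formula 20). [folklore] -/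
def slotReach (p e : ℕ) : ℤ :=
  ((e : ℤ) - 1) + (innerCond p e - rOutSharp p e)

/-- Cell reach slack at label `j` with Kummer-root order `mq`: `(j+1)·D − (j²−1)·mq − e` (`≥ 0` ⟺ row 20's cell is POS). [folklore] -/
def cellReachSlack (p e j : ℕ) (mq : ℤ) : ℤ :=
  ((j : ℤ) + 1) * slotReach p e - ((j : ℤ) ^ 2 - 1) * mq - (e : ℤ)

/-- The cell slack counted in whole `p`-LEVELS (conservative volume currency): `⌊slack/e⌋` (Lean `Int` division = floor for `e > 0`). [folklore] -/
def cellLevels (p e j : ℕ) (mq : ℤ) : ℤ :=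
  cellReachSlack p e j mq / (e : ℤ)

/-- THE LEDGER at one bad place: `Σ_{j=1}^{l⋆} ⌊cellReachSlack_j / e⌋` (labels `j = i+1`, uniform procession weights). [folklore] -/
def ledgerSum (lstar p e : ℕ) (mq : ℤ) : ℤ :=
  ((List.range lstar).map fun i : ℕ => cellLevels p e (i + 1) mq).sum

/-- The per-place ledger cell `0 ≤ ledgerSum` (decidable integer arithmetic; no instance declared — evaluate `0 ≤ ledgerSum …` by `decide`). [folklore] -/
def LedgerCell (lstar p e : ℕ) (mq : ℤ) : Prop :=
  0 ≤ ledgerSum lstar p e mq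

/-! ## §2. The candidate (abstract fibres) -/

/-- **`HStarReachLedger` — R-H candidate «reach-ledger» (lens NEARMISS seat 1).** Over abstract fibres `Fib p` of places above each rational
prime with a bad-place predicate, local absolute ramification index `e` and Kummer-root order `mq` (both `w`-units): at EVERY bad place the
label-averaged mover-reach ledger, counted in `p`-levels, is nonnegative. Hypothesis shape only; weaker than the cellwise reach law of rows
15/20, NOT sufficient for the cellwise hull containment S_H, offered as Statement-sufficient through the volume door (b).
[R-H candidate, hypothesis — not a fact] [claim: Mochizuki2012, status: disputed] -/
@[claim "Mochizuki2012" "disputed"]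
def HStarReachLedger (lstar : ℕ) (Fib : Nat.Primes → Type) (bad : ∀ pp, Fib pp → Prop)
    (e : ∀ pp, Fib pp → ℕ) (mq : ∀ pp, Fib pp → ℤ) : Prop :=
  ∀ (pp : Nat.Primes) (w : Fib pp), bad pp w → LedgerCell lstar (pp : ℕ) (e pp w) (mq pp w)

/-! ## §3. The instance at the genuine `K`-level datum `Cor312Prov.pilotDataOfK D K` -/

section Genuine

open NumberField IsDedekindDomain Literature.IUT.HodgeTheaters Summit.ABC.IUTFork.Thm311 Summit.ABC.IUTFork.Thm311.Real
  Summit.ABC.IUTFork.Cor312 Summit.ABC.IUTFork.Cor312Prov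

variable {F K Fbar : Type} [Field F] [NumberField F] [Field K] [NumberField K] [Algebra F K] [Field Fbar]
  [Algebra F Fbar] [Algebra K Fbar] {E : WeierstrassCurve F} [E.IsElliptic] {l : ℕ} {Pb : BadPlacePredicates K}
  (D : InitialThetaData F K Fbar E l Pb)

/-- **«reach-ledger» AT THE GENUINE `K`-LEVEL DATUM**: `HStarReachLedger` over the fibres `x ∣ p` of `Cor312Prov.pilotDataOfK D K`, bad :=
«`placeOf x ∈ S`» (as `Repair.RHSlotReach.SlotReachWindowK`), labels `Fin l⋆`, with the numeric dictionary `e x := absRamificationIdx` of `K_x`,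
`mq x := ord_x` of the realising Kummer root (`= e_x·ord_v(q_v)/(2l)`, [IUTchII] p. 2). This is the `hH` binder the k2 desk's volume glue would
consume (door (b): NEW surplus lemma + `ObstructionSS28Window.statement_iff_avg_cellSlack` ⟹ `Cor312.Setting.Statement` at
`settingPrVolSharp (pilotDataOfK D K) …`). [R-H candidate, hypothesis — not a fact] [claim: Mochizuki2012, status: disputed] -/
@[claim "Mochizuki2012" "disputed"]
def HStarReachLedgerK (e : ∀ pp : Nat.Primes, (thetaIndex (pilotDataOfK D K)).Fibre (.inr pp) → ℕ)
    (mq : ∀ pp : Nat.Primes, (thetaIndex (pilotDataOfK D K)).Fibre (.inr pp) → ℤ) : Prop :=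
  HStarReachLedger (thetaIndex (pilotDataOfK D K)).lstar (fun pp => (thetaIndex (pilotDataOfK D K)).Fibre (.inr pp))
    (fun pp w => haveI : Fact (pp : ℕ).Prime := ⟨pp.2⟩; placeOf (pilotDataOfK D K) pp.1 w ∈ (pilotDataOfK D K).S) e mq

/-- `HStarReachLedgerK` unfolds to the per-place ledger cells at the bad fibre points. [folklore] -/
theorem hStarReachLedgerK_iff (e : ∀ pp : Nat.Primes, (thetaIndex (pilotDataOfK D K)).Fibre (.inr pp) → ℕ)
    (mq : ∀ pp : Nat.Primes, (thetaIndex (pilotDataOfK D K)).Fibre (.inr pp) → ℤ) :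
    HStarReachLedgerK D e mq ↔
      ∀ (pp : Nat.Primes) (w : (thetaIndex (pilotDataOfK D K)).Fibre (.inr pp)),
        (haveI : Fact (pp : ℕ).Prime := ⟨pp.2⟩; placeOf (pilotDataOfK D K) pp.1 w ∈ (pilotDataOfK D K).S) →
          LedgerCell (thetaIndex (pilotDataOfK D K)).lstar (pp : ℕ) (e pp w) (mq pp w) :=
  Iff.rfl

end Genuine

/-! ## §4. Pre-registered sanity cells (HEX strip, local type `e(v∣7) = 1`: `p = 7`, `e_w = l`, `m_q = k`), by `decide` -/

/-- Column values at `(p, e) = (7, 13)`: `r_out♯ = −6`, inner conductor `3`, slot reach `D = 21` (= HULL-REACH-K1 row 20's donor). -/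
example : rOutSharp 7 13 = -6 ∧ innerCond 7 13 = 3 ∧ slotReach 7 13 = 21 := by decide

/-- `l = 13` (`l⋆ = 6`), type 1: the cellwise reach law stops at `k = 3` (top label), the ledger holds through `k = 5` and fails at `k = 6`. -/
example : 0 ≤ cellReachSlack 7 13 6 3 ∧ ¬ 0 ≤ cellReachSlack 7 13 6 4 := by decide

example : 0 ≤ ledgerSum 6 7 13 5 ∧ ¬ 0 ≤ ledgerSum 6 7 13 6 := by decide

/-- The ledger values themselves (`489 − 85k` before flooring; floored level sums): `k = 5 ↦ 2`, `k = 6 ↦ −4`. -/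
example : ledgerSum 6 7 13 5 = 2 ∧ ledgerSum 6 7 13 6 = -4 := by decide

/-- `l = 11` (`l⋆ = 5`), type 1: ledger holds through `k = 4`, fails at `k = 5`; `l = 5` (`l⋆ = 2`): holds through `k = 2`, fails at `k = 3`. -/
example : 0 ≤ ledgerSum 5 7 11 4 ∧ ¬ 0 ≤ ledgerSum 5 7 11 5 ∧ 0 ≤ ledgerSum 2 7 5 2 ∧ ¬ 0 ≤ ledgerSum 2 7 5 3 := by decide

end Summit.ABC.IUTFork.Repair.RH.ReachLedger

end
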